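import Mathlib.Geometry.Manifold.MFDeriv.Basic
import Mathlib.MeasureTheory.Measure.Lebesgue.Basic
import Literature.Geometry.Lorentzian.Geodesic
import Literature.Geometry.Lorentzian.Causality
import Literature.Geometry.Lorentzian.Hypersurface
import Literature.Geometry.Lorentzian.Development
import HarnessLib

-- provenance: harness21/H21/H21/Prelude/Lorentz/NullInfinity.lean @ 3d603bd (interim HEAD d8f2665); M5 mechanical rewrite
-- D-0014 sorry-free migration + `HasLeviCivita` dependency-drift fix (prover-migrate-pool-B-g20-0, 2026-08-13)
-- D-0026 debt hygiene: the parametrised predicates `HasCompleteFutureNullInfinity` / `HasExtendibleNullConeGenerators`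
-- re-signed with their binders `(N) [TopologicalSpace X]` explicit (identical telescopes, bodies untouched), so they read
-- as the DEFINITIONS they are and not as closed named facts (literature-prover provefact seat ce6636f33c, 2026-08-15)
/-!
# Intrinsic completeness of future null infinity (trunk G08 = T-LORENTZ, item C17)

Christodoulou's *intrinsic* notion of a **complete future null infinity** of a spacetime
`(M, g, τ)` developing from data on a hypersurface `ι : X → M` (with future unit normal `N`),
formulated without a conformal boundary `𝓘⁺`: it only speaks about affine lengths of
future-directed null geodesics normalised against the unit normal of the data hypersurface, and
about causal futures `J⁺(ι B)` of compact pieces `B ⊆ X` of the data. This is the notion consumed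
by the weak cosmic censorship statements (**gr.S02**, **gr.S21**) and by the stability theorems
(**gr.S04**–**gr.S06**); the Penrose conformal picture lives in
`Literature.Prelude.Lorentz.ConformalInfinity`.

## Main definitions (`namespace Literature.Lorentz`)

* `LorentzianMetric.futureNullConeBoundary g τ ι B := frontier (J⁺(ι '' B))`, the "future null
  cone" `C⁺(B) = ∂J⁺(B)` of Christodoulou.
* `LorentzianMetric.IsNormalisedNullRayFrom g τ ι N p γ dom`: `γ` is a maximal (inextendible in
  `M`) geodesic of the Levi-Civita connection with domain `dom ∋ 0`, starting at `γ 0 = ι p` with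
  future-directed null velocity `L = γ' 0` normalised by `g(L, N p) = -1` (Christodoulou's
  normalisation of the affine parameter: the `N`-component of `L` is `1`).
* `sojournTime γ dom A := volume {t ∈ dom | 0 ≤ t ∧ γ t ∈ A}`: the affine (Lebesgue) time the
  curve `γ` spends in `A ⊆ M` after parameter `0`.
* `LorentzianMetric.HasCompleteFutureNullInfinity g τ ι N` (**gr.S16**, primary, *sojourn form*; a
  definition of a property of the spacetime, not a named fact):
  there is a compact `B₀ ⊆ X` such that for every `s > 0` there is a compact `B₁ ⊆ X` such that
  every normalised future null ray starting on `X ∖ B₁` is either future complete (its affine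
  domain is unbounded above) or spends affine time `≥ s` inside `J⁺(ι B₀)`.
* Documented variant (reading (a) of the review, **not** used by statements):
  `LorentzianMetric.IsBoundaryGeneratorStart`, `LorentzianMetric.GeneratorExtendsTo`,
  `LorentzianMetric.HasExtendibleNullConeGenerators` — "the null geodesic generators of `∂J⁺(ι B)`,
  `B ⊇ B₀` compact, extend in `M` to affine parameter `s`".
* `Development.HasCompleteFutureNullInfinity 𝒟`, `Development.HasIncompleteFutureNullInfinity 𝒟`
  for a development `𝒟` of an initial data set, and the invariance under isometry of
  developments `Development.hasCompleteFutureNullInfinity_iff_of_isIsometricTo`.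

Sanity theorems (`minkowski_hasCompleteFutureNullInfinity`, `kerr_hasCompleteFutureNullInfinity`)
live in `Literature.Prelude.Lorentz.ModelData`.

## The source being rendered

Christodoulou, *On the global initial value problem and the issue of singularities*, CQG **16**
(1999) A23–A35, pp. A26–A27, defines, for a development `(M, g)` of data on `X` and a compact
`B ⊆ X` with `J⁺(B) ≠ M`, the future boundary `C⁺(B) = ∂J⁺(B)`; it is generated by null geodesic
segments starting on `∂B`, whose tangent `L` he normalises by `g(L, N) = -1` against the future
unit normal `N` of `X`. He then says that `M` has **complete future null infinity** if there is a
compact `B₀ ⊆ X` such that for every compact `B ⊇ B₀` and every `s > 0` "the null geodesic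
generators of `C⁺(B)`, so normalised, can be extended (towards the future) to affine parameter
values `≥ s`" (the intended reading involves the domain of dependence / `J⁺` of `B₀`, cf.
Dafermos–Rodnianski, *Lectures on black holes and linear waves*, arXiv:0811.0354, §2.6.2, and
Dafermos, CQG **22** (2005) 2221–2232, §1, where *incompleteness* of `𝓘⁺` for naked singularities
is witnessed quantitatively by the affine length of ingoing null segments inside `J⁺` of a fixed
outgoing cone staying bounded).

## Why the sojourn form (architect's analysis, Outline §4.2, reproduced verbatim in substance)

Two candidate literal readings were on the table:
(a) "generators of `∂J⁺(ι B)`, `B ⊇ B₀`, extend **in `M`** to affine length `s`";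
(b) "… **remain in `∂J⁺(ι B)`** up to affine length `s`". Tests:

* (b) fails in Minkowski space (review F7: take `B = B₀ ∪ {q}` with `q ∈ X` a point at distance
  `d` from `B₀`; the generators of `∂J⁺(ι B)` issuing from `q` towards `B₀` leave `∂J⁺(ι B)` —
  they enter the interior of `J⁺(ι B₀)` — after affine time `≈ d/2`, however large `B₀` is).
* (a) is passed by the MGHD of naked-singularity data posed on a pre-singular slice: every
  boundary-generator start lies at radius `≥ R₀ :=` radius of `B₀`; outgoing rays from `X` have
  retarded time `u ≤ 0 < u_p` (the Cauchy horizon) and are complete; ingoing rays from radius `R`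
  meet the Cauchy horizon only after affine time `≈ (R + u_p)/2 ≥ R₀/2`, so choosing `R₀ = 2s`
  passes — hence under (a) **gr.S21** (Rodnianski–Shlapentokh-Rothman: naked singularities have
  incomplete `𝓘⁺`) would be *false* and WCC would not exclude Christodoulou's own examples.

What incomplete `𝓘⁺` means quantitatively (Dafermos CQG 22 (2005) §1: affine length of ingoing
null segments inside `J⁺` of a fixed outgoing cone tends to infinity) is captured by the
**sojourn form** adopted here:
`∃ B₀ ∀ s ∃ B₁ ∀` normalised future null rays `γ` from `X ∖ B₁`: `γ` future-complete `∨` affine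
time spent in `J⁺(ι B₀)` `≥ s`.

**Test table** (Outline §4.2):

* Minkowski — ✓ (null geodesically complete: first disjunct;
  `hasCompleteFutureNullInfinity_of_isNullGeodesicallyComplete`);
* Kerr / Schwarzschild exterior charts `Kerr.region a r₀` — ✓ (ingoing rays reach `r = r₀` only
  after affine time `≳` their starting radius);
* Oppenheimer–Snyder-type collapse black holes — ✓ (rays die in the singularity only after a long
  sojourn; `∃ B₀` lets `B₀` enclose the trapped region, matching Dafermos–Rodnianski's remark on
  the role of `B₀`);
* naked-singularity MGHDs (pre-singular slice) — ✗ (radial ingoing rays: sojourn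
  `≤ (u_p + R₀)/2`, bounded in terms of the starting radius);
* Minkowski truncated at `t < T` — ✗ (every ray from the slice `t = 0` has affine domain bounded
  by `T` and sojourn `≤ T`).

Reading (a) is kept as the documented variant `HasExtendibleNullConeGenerators`.

## Mathlib

Mathlib (at the pin) has no Lorentzian causality, null infinity or geodesics
(`rg -i 'null infinity|scri|nullCone' Mathlib` is empty). We use `frontier`, `IsCompact`,
`BddAbove`, `MeasureTheory.volume` on `ℝ` (Lebesgue measure, `Mathlib.MeasureTheory.Measure.
Lebesgue.Basic`) and `ENNReal.ofReal`; from H21 we use `velocity`, `IsGeodesicOn`,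
`IsMaximalGeodesicOn` (`Geodesic`), `causalFuture` (`Causality`), `NormalField` (`Hypersurface`),
`PseudoRiemannianMetric.leviCivita` (`LeviCivita`), `Development` (`Development`).

## Design choices

* `X` is an arbitrary topological space and `ι : X → M` an arbitrary map in the general
  definitions (only compactness of subsets of `X` and the values `ι p`, `N p` are used); the
  development versions specialise to `𝒟.embed`, `𝒟.normal`.
* The affine parameter is fixed only up to the normalisation `g(γ' 0, N p) = -1` at the starting
  point, exactly as in CQG 16, p. A26; "future complete" for a maximal geodesic is
  `¬ BddAbove dom`.
* `sojournTime` is an extended nonnegative real (it is `∞` for a complete ray staying in `A`), so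
  the comparison with `s` is `ENNReal.ofReal s ≤ sojournTime …`.
* The tangent spaces `T_{γ 0} M` and `T_{ι p} M` are both `E` by definition, so `γ' 0` may be
  paired with `N p` without transport (as in `IsGeodesicallyComplete`).
* For compact `X` (no asymptotic region) the definition holds vacuously with `B₁ = univ`; the
  notion is meant for asymptotically flat data, as in the source.

## References

* D. Christodoulou, *On the global initial value problem and the issue of singularities*,
  Class. Quantum Grav. 16 (1999) A23–A35, pp. A26–A27.
* M. Dafermos, I. Rodnianski, *Lectures on black holes and linear waves*, arXiv:0811.0354,
  §2.6.2 (Christodoulou's formulation of completeness of `𝓘⁺`), §2.6.3.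
* M. Dafermos, *Spherically symmetric spacetimes with a trapped surface*, Class. Quantum Grav. 22
  (2005) 2221–2232, §1.
* I. Rodnianski, Y. Shlapentokh-Rothman, *Naked singularities for the Einstein vacuum equations:
  the exterior solution*, Ann. of Math. 198 (2023), Thm. 1.1.
-/

open Bundle Set MeasureTheory
open scoped Manifold ContDiff Topology ENNReal

noncomputable section

namespace Literature.Geometry.Lorentzian

/-! ### Sojourn time of a curve in a set -/

section Sojourn

variable {M : Type*}

/-- The **sojourn time** of the curve `γ : ℝ → M` with parameter domain `dom` in the set `A ⊆ M`,
counted from parameter `0` onwards: the Lebesgue measure of `{t ∈ dom | 0 ≤ t ∧ γ t ∈ A}`, an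
extended nonnegative real (`∞` if `γ` stays in `A` for unbounded affine time). For an affinely
parametrised null geodesic this is the affine time spent in `A`, the quantity whose unboundedness
expresses completeness of `𝓘⁺` in Dafermos, CQG 22 (2005) 2221, §1; Christodoulou, CQG 16 (1999)
A23, p. A27. [folklore] -/
def sojournTime (γ : ℝ → M) (dom : Set ℝ) (A : Set M) : ℝ≥0∞ :=
  volume {t ∈ dom | 0 ≤ t ∧ γ t ∈ A}

/-- The sojourn time is monotone in the target set. [folklore] -/
lemma sojournTime_mono (γ : ℝ → M) (dom : Set ℝ) {A A' : Set M} (h : A ⊆ A') :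
    sojournTime γ dom A ≤ sojournTime γ dom A' :=
  measure_mono fun _ ht ↦ ⟨ht.1, ht.2.1, h ht.2.2⟩

/-- The sojourn time is monotone in the parameter domain. [folklore] -/
lemma sojournTime_mono_left (γ : ℝ → M) {dom dom' : Set ℝ} (h : dom ⊆ dom') (A : Set M) :
    sojournTime γ dom A ≤ sojournTime γ dom' A :=
  measure_mono fun _ ht ↦ ⟨h ht.1, ht.2⟩

/-- The sojourn time in `A` is at most the measure of the nonnegative part of the domain: a ray
with affine domain bounded above by `T` has sojourn time `≤ T` in every set. [folklore] -/
lemma sojournTime_le_volume (γ : ℝ → M) (dom : Set ℝ) (A : Set M) :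
    sojournTime γ dom A ≤ volume (dom ∩ Ici (0 : ℝ)) :=
  measure_mono fun _ ht ↦ ⟨ht.1, ht.2.1⟩

/-- The sojourn time in the whole manifold is the measure of the nonnegative part of the
domain. [folklore] -/
@[simp]
lemma sojournTime_univ (γ : ℝ → M) (dom : Set ℝ) :
    sojournTime γ dom (univ : Set M) = volume (dom ∩ Ici (0 : ℝ)) := by
  simp only [sojournTime, mem_univ, and_true]
  rfl

end Sojourn

variable {E : Type*} [NormedAddCommGroup E] [NormedSpace ℝ E] {H : Type*} [TopologicalSpace H]
  {I : ModelWithCorners ℝ E H} {M : Type*} [TopologicalSpace M] [ChartedSpace H M]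
  [IsManifold I ∞ M] {X : Type*}

namespace LorentzianMetric

variable (g : LorentzianMetric I ∞ M) (τ : TimeOrientation g) (ι : X → M)

/-! ### Future null cones of pieces of the data -/

/-- The **future null cone boundary** `C⁺(B) := ∂J⁺(ι B)` of a piece `B ⊆ X` of the data
hypersurface `ι : X → M`: the topological frontier of the causal future of `ι '' B`. For compact
`B` with `J⁺(B) ≠ M` in a globally hyperbolic development it is an achronal Lipschitz
hypersurface generated by null geodesic segments issuing from `ι (∂B)`. Christodoulou, CQG 16
(1999) A23, p. A26; Hawking–Ellis 1973, §6.3, Prop. 6.3.1. [cite: HawkingEllis1973, §6.3  Prop. 6.3.1] -/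
def futureNullConeBoundary (B : Set X) : Set M :=
  frontier (g.causalFuture τ (ι '' B))

variable {g τ ι} in
/-- The future null cone boundary is closed. [folklore] -/
lemma isClosed_futureNullConeBoundary (B : Set X) :
    IsClosed (g.futureNullConeBoundary τ ι B) :=
  isClosed_frontier

/-! ### Normalised null rays and the sojourn form of completeness of `𝓘⁺` -/

-- M5 dependency-drift fix: the Levi-Civita connection `g.leviCivita` of the accepted `LeviCivita`
-- API takes the standing instance hypothesis `[g.HasLeviCivita]` (the conclusion of the named fact
-- `PseudoRiemannianMetric.isCovariantDerivativeOn_leviCivitaFun`, O'Neill 1983, Thm. 3.11), so every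
-- notion below built on geodesics of `g` binds it as a section instance argument.
variable [FiniteDimensional ℝ E] [CompleteSpace E] [g.HasLeviCivita] (N : NormalField I ι)

/-- `γ` with affine domain `dom` is a **normalised future null ray from `p ∈ X`**: `γ` is a
maximal (inextendible in `M`) geodesic of the Levi-Civita connection of `g` on the open interval
`dom ∋ 0`, it starts at `γ 0 = ι p`, its initial velocity `L = γ' 0` is null and future-directed,
and the affine parameter is normalised against the future unit normal `N p` of the data
hypersurface by `g(L, N p) = -1` (i.e. the component of `L` along `N p` is `+1`). This is
Christodoulou's normalisation of the tangents of the generators of `C⁺(B)`. Christodoulou, CQG 16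
(1999) A23, p. A26; Dafermos–Rodnianski, arXiv:0811.0354, §2.6.2. [cite: arXiv08110354] -/
def IsNormalisedNullRayFrom (p : X) (γ : ℝ → M) (dom : Set ℝ) : Prop :=
  IsMaximalGeodesicOn g.leviCivita γ dom ∧ 0 ∈ dom ∧ γ 0 = ι p ∧ g.IsNull (velocity I γ 0) ∧
    τ.IsFutureDirected (velocity I γ 0) ∧ g.val (ι p) (velocity I γ 0) (N p) = -1

variable {g τ ι N} in
omit [CompleteSpace E] in
/-- A normalised null ray is a maximal geodesic on its domain. [folklore] -/
lemma IsNormalisedNullRayFrom.isMaximalGeodesicOn {p : X} {γ : ℝ → M} {dom : Set ℝ}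
    (h : g.IsNormalisedNullRayFrom τ ι N p γ dom) : IsMaximalGeodesicOn g.leviCivita γ dom :=
  h.1

variable {g τ ι N} in
omit [CompleteSpace E] in
/-- The parameter `0` belongs to the domain of a normalised null ray. [folklore] -/
lemma IsNormalisedNullRayFrom.zero_mem {p : X} {γ : ℝ → M} {dom : Set ℝ}
    (h : g.IsNormalisedNullRayFrom τ ι N p γ dom) : (0 : ℝ) ∈ dom :=
  h.2.1

variable {g τ ι N} in
omit [CompleteSpace E] in
/-- A normalised null ray from `p` starts at `ι p`. [folklore] -/
lemma IsNormalisedNullRayFrom.apply_zero {p : X} {γ : ℝ → M} {dom : Set ℝ}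
    (h : g.IsNormalisedNullRayFrom τ ι N p γ dom) : γ 0 = ι p :=
  h.2.2.1

variable {g τ ι N} in
omit [CompleteSpace E] in
/-- The initial velocity of a normalised null ray is null. [folklore] -/
lemma IsNormalisedNullRayFrom.isNull_velocity {p : X} {γ : ℝ → M} {dom : Set ℝ}
    (h : g.IsNormalisedNullRayFrom τ ι N p γ dom) : g.IsNull (velocity I γ 0) :=
  h.2.2.2.1

variable {g τ ι N} in
omit [CompleteSpace E] in
/-- The initial velocity of a normalised null ray is future-directed. [folklore] -/
lemma IsNormalisedNullRayFrom.isFutureDirected_velocity {p : X} {γ : ℝ → M} {dom : Set ℝ}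
    (h : g.IsNormalisedNullRayFrom τ ι N p γ dom) : τ.IsFutureDirected (velocity I γ 0) :=
  h.2.2.2.2.1

variable {g τ ι N} in
omit [CompleteSpace E] in
/-- The normalisation `g(γ' 0, N p) = -1` of a normalised null ray. [folklore] -/
lemma IsNormalisedNullRayFrom.val_velocity_normal {p : X} {γ : ℝ → M} {dom : Set ℝ}
    (h : g.IsNormalisedNullRayFrom τ ι N p γ dom) : g.val (ι p) (velocity I γ 0) (N p) = -1 :=
  h.2.2.2.2.2

/-- **gr.S16** (complete future null infinity in Christodoulou's intrinsic sense; Christodoulou,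
CQG 16 (1999) A23, pp. A26–A27; Dafermos–Rodnianski, arXiv:0811.0354, §2.6.2; Dafermos, CQG 22
(2005) 2221, §1). The time-oriented Lorentzian manifold `(M, g, τ)`, viewed as a development of
data on `ι : X → M` with future unit normal `N`, **has complete future null infinity** if there is
a compact `B₀ ⊆ X` such that for every `s > 0` there is a compact `B₁ ⊆ X` such that every
normalised future null ray `γ` (maximal null geodesic, `γ 0 = ι p`, `g(γ' 0, N p) = -1`) starting
at a point `p ∉ B₁` is either **future complete** (its affine domain is unbounded above) or
**spends affine time at least `s` in `J⁺(ι B₀)`**.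

This is explicitly the **H21 rendering (sojourn form)** of Christodoulou's intrinsic notion —
"for each `s > 0` the normalised null generators of `C⁺(B)`, `B ⊇ B₀`, extend to affine
parameter `≥ s`" — chosen because it passes the test table of the module docstring: Minkowski ✓,
Kerr exterior charts ✓, gravitational-collapse black holes ✓, naked-singularity MGHDs ✗,
time-truncated Minkowski ✗ (Outline §4.2). No conformal boundary is involved; when a Penrose
completion exists this is intended to be equivalent to completeness of `𝓘⁺`
(Dafermos–Rodnianski §2.6.3).

This is a **definition** — a predicate on the data `(M, g, τ, ι, N)`, parametrised by the metric
`g`, the time orientation `τ`, the data map `ι`, its future unit normal `N` and the topology of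
`X` (the last two bound explicitly in the signature) — and **not** a named fact: it holds for
some spacetimes and fails for others (test table above: Minkowski ✓ via
`hasCompleteFutureNullInfinity_of_isNullGeodesicallyComplete`; time-truncated Minkowski ✗; the
Kerr chart viewed from all of `Kerr.slice` ✗, `ModelData`, note before
`kerr_hasCompleteFutureNullInfinity`), exactly as in the source, where completeness of `𝓘⁺` is
the *property* asserted by weak cosmic censorship and violated by naked-singularity
developments (Dafermos–Rodnianski, arXiv:0811.0354, §2.5.4 and §2.6.2). There is therefore no
`HasCompleteFutureNullInfinity_holds`. [cite: arXiv08110354] -/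
def HasCompleteFutureNullInfinity (N : NormalField I ι) [TopologicalSpace X] : Prop :=
  ∃ B₀ : Set X, IsCompact B₀ ∧ ∀ s : ℝ, 0 < s → ∃ B₁ : Set X, IsCompact B₁ ∧
    ∀ p ∉ B₁, ∀ (γ : ℝ → M) (dom : Set ℝ), g.IsNormalisedNullRayFrom τ ι N p γ dom →
      ¬ BddAbove dom ∨ ENNReal.ofReal s ≤ sojournTime γ dom (g.causalFuture τ (ι '' B₀))

section Complete

variable [TopologicalSpace X]

variable {g τ ι N} in
omit [CompleteSpace E] in
/-- If every normalised future null ray from the data hypersurface is future complete (e.g. if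
`g` is null geodesically complete), then `(M, g, τ)` has complete future null infinity in the
sojourn sense (take `B₀ = B₁ = ∅`). This is the Minkowski column of the test table.
Christodoulou, CQG 16 (1999), p. A27. [folklore] -/
theorem hasCompleteFutureNullInfinity_of_forall_not_bddAbove
    (h : ∀ (p : X) (γ : ℝ → M) (dom : Set ℝ), g.IsNormalisedNullRayFrom τ ι N p γ dom →
      ¬ BddAbove dom) :
    g.HasCompleteFutureNullInfinity τ ι N :=
  ⟨∅, isCompact_empty, fun _ _ ↦ ⟨∅, isCompact_empty, fun p _ γ dom hγ ↦ Or.inl (h p γ dom hγ)⟩⟩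

variable {g ι N} in
/-- On a Hausdorff manifold without boundary with `C¹` Levi-Civita connection, a **null
geodesically complete** metric has complete future null infinity w.r.t. any data hypersurface:
by uniqueness of maximal geodesics (the named fact `IsGeodesicOn.eqOn_of_velocity_eq` of
`Geodesic`, hypothesis `huniq`) every normalised null ray is defined on all of `ℝ`.
O'Neill 1983, Ch. 3, p. 68; Christodoulou, CQG 16 (1999), p. A27 (Minkowski space). [cite: ONeill1983, Ch. 3  p. 68] -/
theorem hasCompleteFutureNullInfinity_of_isNullGeodesicallyComplete [T2Space M]
    [BoundarylessManifold I M]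
    [CovariantDerivative.ContMDiffCovariantDerivative g.leviCivita 1]
    (huniq : IsGeodesicOn.eqOn_of_velocity_eq (cov := g.leviCivita))
    (h : g.IsNullGeodesicallyComplete) (τ : TimeOrientation g) :
    g.HasCompleteFutureNullInfinity τ ι N := by
  refine hasCompleteFutureNullInfinity_of_forall_not_bddAbove fun p γ dom hγ ↦ ?_
  obtain ⟨γ', hγ', h0, hv⟩ := h (γ 0) (velocity I γ 0) hγ.isNull_velocity
  have hmax := hγ.isMaximalGeodesicOn
  have heq : EqOn γ γ' dom :=
    huniq hmax.isOpen hmax.2.1 hmax.isGeodesicOn (hγ'.isGeodesicOn dom) hγ.zero_mem h0.symm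
      hv.symm
  have huniv : univ = dom :=
    hmax.2.2.2 γ' univ isOpen_univ ordConnected_univ (subset_univ _) hγ' heq
  rw [← huniv]
  exact not_bddAbove_univ

end Complete

/-! ### Documented variant: extendibility of the null cone generators (reading (a)) -/

variable [TopologicalSpace X] in
/-- `L ∈ T_{ι p} M` is the **normalised initial tangent of a generator of `C⁺(B) = ∂J⁺(ι B)` at
`p`**: `p` lies on the frontier of `B` in `X`, `L` is null, future-directed and normalised by
`g(L, N p) = -1`, and the geodesic with initial data `(ι p, L)` initially runs inside the future
null cone boundary `C⁺(B)` (for small positive affine parameter). Christodoulou, CQG 16 (1999)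
A23, p. A26 ("`C⁺(B)` is generated by null geodesic segments starting at `∂B`, with tangent `L`
normalised by `g(L, N) = -1`"). [folklore] -/
def IsBoundaryGeneratorStart (B : Set X) (p : X) (L : TangentSpace I (ι p)) : Prop :=
  p ∈ frontier B ∧ g.IsNull L ∧ τ.IsFutureDirected L ∧ g.val (ι p) L (N p) = -1 ∧
    ∃ (γ : ℝ → M) (ε : ℝ), 0 < ε ∧ IsGeodesicOn g.leviCivita γ (Ioo (-ε) ε) ∧ γ 0 = ι p ∧
      velocity I γ 0 = L ∧ ∀ t ∈ Ioo 0 ε, γ t ∈ g.futureNullConeBoundary τ ι B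

/-- The geodesic with initial data `(ι p, L)` **extends in `M` to affine parameter `s`**: there is
a geodesic of the Levi-Civita connection defined on an open interval containing `[0, s]` with
`γ 0 = ι p`, `γ' 0 = L`. Christodoulou, CQG 16 (1999) A23, p. A27 ("can be extended to values of
the affine parameter `≥ s`"). [folklore] -/
def GeneratorExtendsTo (p : X) (L : TangentSpace I (ι p)) (s : ℝ) : Prop :=
  ∃ (γ : ℝ → M) (ε : ℝ), 0 < ε ∧ IsGeodesicOn g.leviCivita γ (Ioo (-ε) (s + ε)) ∧ γ 0 = ι p ∧
    velocity I γ 0 = L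

variable {g ι} in
omit [CompleteSpace E] in
/-- Extendibility to affine parameter `s` is monotone: extending to `s` extends to every
`s' ≤ s`. [folklore] -/
lemma GeneratorExtendsTo.mono {p : X} {L : TangentSpace I (ι p)} {s s' : ℝ}
    (h : g.GeneratorExtendsTo ι p L s) (hs : s' ≤ s) : g.GeneratorExtendsTo ι p L s' := by
  obtain ⟨γ, ε, hε, hγ, h0, hL⟩ := h
  exact ⟨γ, ε, hε, hγ.mono (Ioo_subset_Ioo le_rfl (by linarith)), h0, hL⟩

/-- **Documented variant, not used by the statements** (reading (a) of Christodoulou's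
definition; Christodoulou, CQG 16 (1999) A23, p. A27; Dafermos–Rodnianski, arXiv:0811.0354,
§2.6.2). `(M, g, τ)` **has extendible null cone generators** w.r.t. the data `ι : X → M`, `N`:
for every `s > 0` there is a compact `B₀ ⊆ X` such that for every compact `B ⊇ B₀` every
normalised generator of `C⁺(B) = ∂J⁺(ι B)` starting at `p ∈ ∂B` with tangent `L` extends **in
`M`** to affine parameter `s`.

Why the statements use `HasCompleteFutureNullInfinity` instead (Outline §4.2): this reading is
satisfied by the maximal globally hyperbolic developments of naked-singularity data posed on a
pre-singular slice (outgoing generators are complete; ingoing generators from radius `R ≥ R₀`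
meet the Cauchy horizon only after affine time `≈ (R + u_p)/2`, so `R₀ = 2 s` works), which would
make **gr.S21** false and weak cosmic censorship vacuous in intent.

Like `HasCompleteFutureNullInfinity` this is a **definition** (a predicate on `(M, g, τ, ι, N)`,
with `N` and the topology of `X` bound explicitly in the signature), not a named fact: it fails,
e.g., for time-truncated Minkowski space and holds for null geodesically complete metrics
(`hasExtendibleNullConeGenerators_of_isNullGeodesicallyComplete`). [cite: arXiv08110354] -/
def HasExtendibleNullConeGenerators (N : NormalField I ι) [TopologicalSpace X] : Prop :=
  ∀ s : ℝ, 0 < s → ∃ B₀ : Set X, IsCompact B₀ ∧ ∀ B : Set X, IsCompact B → B₀ ⊆ B →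
    ∀ (p : X) (L : TangentSpace I (ι p)), g.IsBoundaryGeneratorStart τ ι N B p L →
      g.GeneratorExtendsTo ι p L s

section Extendible

variable [TopologicalSpace X]

variable {g ι N} in
omit [CompleteSpace E] in
/-- A null geodesically complete metric has extendible null cone generators (every null
geodesic is defined on all of `ℝ`). O'Neill 1983, Ch. 3, p. 68. [cite: ONeill1983, Ch. 3  p. 68] -/
theorem hasExtendibleNullConeGenerators_of_isNullGeodesicallyComplete
    (h : g.IsNullGeodesicallyComplete) (τ : TimeOrientation g) :
    g.HasExtendibleNullConeGenerators τ ι N := by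
  intro s hs
  refine ⟨∅, isCompact_empty, fun B _ _ p L hL ↦ ?_⟩
  obtain ⟨γ, hγ, h0, hv⟩ := h (ι p) L hL.2.1
  exact ⟨γ, 1, one_pos, hγ.isGeodesicOn _, h0, hv⟩

end Extendible

end LorentzianMetric

/-! ### Completeness of `𝓘⁺` for developments of initial data -/

namespace Development

universe u

variable {n : ℕ} {X' : Type u} [TopologicalSpace X'] [ChartedSpace (EuclideanSpace ℝ (Fin n)) X']
  [IsManifold (𝓡 n) ∞ X'] [ConnectedSpace X'] {D : InitialDataSet (𝓡 n) X'}

/-- The development `𝒟 = (M, g, τ, ι, ν)` of the initial data set `D` **has complete future null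
infinity** (Christodoulou's intrinsic sense, sojourn form **gr.S16**):
`HasCompleteFutureNullInfinity` for its metric, time orientation, embedding `ι = 𝒟.embed` of the
data manifold and future unit normal `ν = 𝒟.normal`, for the Levi-Civita connection of `g`
granted its existence (the standing hypothesis `[g.HasLeviCivita]` is bound inside, exactly as in
`Development.induced_k` and `VacuumDevelopment.isRicciFlat`; a user holding the named fact
`PseudoRiemannianMetric.isCovariantDerivativeOn_leviCivitaFun` instantiates it with
`HasLeviCivita.of`). Christodoulou, CQG 16 (1999) A23, pp. A26–A27; Dafermos–Rodnianski,
arXiv:0811.0354, §2.6.2. [cite: arXiv08110354] -/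
def HasCompleteFutureNullInfinity (𝒟 : Development D) : Prop :=
  ∀ [𝒟.metric.HasLeviCivita],
    𝒟.metric.HasCompleteFutureNullInfinity 𝒟.timeOrientation 𝒟.embed 𝒟.normal

/-- The development `𝒟` **has incomplete future null infinity**: it does not have complete
future null infinity in Christodoulou's intrinsic sense. This is the conclusion of the
naked-singularity theorems (Christodoulou, Ann. of Math. 140 (1994); Rodnianski–
Shlapentokh-Rothman, Ann. of Math. 198 (2023), Thm. 1.1) and the property excluded generically
by weak cosmic censorship. Christodoulou, CQG 16 (1999) A23, p. A27. [folklore] -/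
def HasIncompleteFutureNullInfinity (𝒟 : Development D) : Prop :=
  ¬ 𝒟.HasCompleteFutureNullInfinity

/-- Unfolding lemma for `HasIncompleteFutureNullInfinity`. [folklore] -/
lemma hasIncompleteFutureNullInfinity_iff (𝒟 : Development D) :
    𝒟.HasIncompleteFutureNullInfinity ↔ ¬ 𝒟.HasCompleteFutureNullInfinity :=
  Iff.rfl

/-- **Completeness of future null infinity is invariant under isometry of developments.** If
`𝒟₁` and `𝒟₂` are isometric as developments of `D` (a time-orientation-preserving isometric
diffeomorphism `ψ` with `ψ ∘ ι₁ = ι₂`), then `𝒟₁` has complete future null infinity iff `𝒟₂`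
does: `ψ` maps maximal null geodesics to maximal null geodesics with the same affine domain,
`J⁺(ι₁ B)` onto `J⁺(ι₂ B)`, and the future unit normal `ν₁` to `ν₂` (the future unit normal of a
spacelike hypersurface being unique), so normalisations and sojourn times agree. In particular
the notion is well defined on the isometry class of the maximal globally hyperbolic development.
Christodoulou, CQG 16 (1999) A23, p. A26 (the definition refers to the MGHD, unique up to
isometry: Choquet-Bruhat–Geroch 1969). Named fact (D-0014). [cite: ChoquetBruhatGeroch1969] -/
def hasCompleteFutureNullInfinity_iff_of_isIsometricTo : Prop :=
  ∀ {𝒟₁ 𝒟₂ : Development D}, 𝒟₁.IsIsometricTo 𝒟₂ →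
    (𝒟₁.HasCompleteFutureNullInfinity ↔ 𝒟₂.HasCompleteFutureNullInfinity)

/-- Incompleteness of future null infinity is invariant under isometry of developments (given the
named fact `hasCompleteFutureNullInfinity_iff_of_isIsometricTo`, hypothesis `hiso`). [folklore] -/
theorem hasIncompleteFutureNullInfinity_iff_of_isIsometricTo
    (hiso : hasCompleteFutureNullInfinity_iff_of_isIsometricTo (D := D)) {𝒟₁ 𝒟₂ : Development D}
    (h : 𝒟₁.IsIsometricTo 𝒟₂) :
    𝒟₁.HasIncompleteFutureNullInfinity ↔ 𝒟₂.HasIncompleteFutureNullInfinity :=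
  not_congr (hiso h)

end Development

end Literature.Geometry.Lorentzian

end
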